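import Literature.AnabelianGeometry.AbsoluteAnabelian.AbsTopICharacterRankPoincareExtension
import HarnessLib

/-!
# [AbsTopI] Lemma 4.5 (iii), Poincaré-extension form — GROUP-THEORETICITY: the power class of `χ^{cyclo}`
# and the number of cusps are invariants of the abstract `G`-module `H^{ab} ⊗ ℚ_l`

Proof-only companion of `AbsTopICharacterRankPoincareExtension.lean` (S. Mochizuki, *Topics in Absolute
Anabelian Geometry I: Generalities* [MochizukiAbsTopI2012], Lemma 4.5 (ii)(iii), kurims manuscript p. 54:
(iii) "the power-equivalence class of the cyclotomic character `χ^{cyclo}_G` may be characterized as …",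
"the divisor of cusps … is a disjoint union of `d_χ(H^{ab} ⊗ ℚ_l) + 1` copies of `Spec(k̃)`", and (ii)
"`d_χ(M)` … depends only on the power-equivalence class of `χ`"; [CombGC] = [MochizukiCombGC2007],
Cor. 2.7 (i) + proof pp. 22–23: "`ι` preserves positive and null `ℚ`-cyclotomic characters … by
Proposition 2.4, (vii), … `ι` preserves the `ℚ`-cyclotomic characters of weight `2` … this data allows one
to compute `r(G′)`"), cell abc-iut, block F, seat abc-iut-f-062 (FACT-LIST schemata F-0222 · F-0223 ·
F-0224).

WHAT IS PROVED — the anabelian CONTENT of the three sentences, for Poincaré extensions: let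
`(V, ρ, χ, C, B)` and `(V', ρ', χ', C', B')` be Poincaré-extension data (stable nonzero quasi-toral `C`,
quotient representation, `G`-equivariant nondegenerate `χ`-valued pairing on `V/C`; non-degenerate `χ`;
`dim V > 0`) for two reference characters `χ, χ'` of the SAME topological group `G`, and `e : V ≅ V'` a
`G`-equivariant `K`-linear isomorphism.  Then
* `pow_eq_pow_of_equivariant`: `χ^a = χ'^{a'}` for some `a, a' > 0` (determinants agree along `e`;
  [CombGC] Prop. 2.4 (iii)/(iv): `det² = χ^m` on an open subgroup of finite index, killed by the index of
  its normal core);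
* `powerEquivalent_of_equivariant`: in fact **`χ^n = χ'^n` for some `n > 0`** — the power-equivalence
  class of `χ^{cyclo}` is DETERMINED by the abstract `G`-module: the realised-weight sets relative to `χ`
  and `χ'` differ by the scaling `a'/a`, and both are finite, contain `0` and are symmetric about `1`
  ([CombGC] Prop. 2.4 (vii), `realisedWeightsSymmetric_of_poincareExtension`), forcing `a = a'`;
* `finrank_cuspidal_eq_of_equivariant`: for CONTINUOUS `χ, χ'` with values in a `T₁` topological field,
  **`dim C = dim C'`** — the number of cusps `r = dim C + 1` is GROUP-THEORETIC
  (`d_χ(V) = d_{χ'}(V)` by Lemma 4.5 (ii) `dChi_eq_of_powerEquivalent`, `= d_{χ'}(V')` along `e`,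
  and `d = dim C` by `dChi_of_poincareExtension`).
No new definitions.  HONEST FRAMING: refereed pre-IUT anabelian geometry (linear algebra of `G`-modules);
the étale-`π₁` instance is not constructed here (FOUNDATIONS row 12); typed ≠ proved for it; nothing here
bears on [IUTchIII] Cor. 3.12.
-/

noncomputable section

open scoped Classical

namespace Literature.AnabelianGeometry.AbsoluteAnabelian.AbsTopI

universe u v w w'

section Rigidity

variable {G : Type u} [Group G] [TopologicalSpace G]
variable {K : Type v} [Field K]
variable {V : Type w} [AddCommGroup V] [Module K V]
variable {V' : Type w'} [AddCommGroup V'] [Module K V']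

/-! ### §1. Bookkeeping: killing a finite quotient; rescaling weights -/

omit [TopologicalSpace G] in
/-- Two characters whose powers agree on a subgroup of finite index have powers agreeing EVERYWHERE
(raise to the index `k` of the normal core: `g^k` lies in it). ("`ℤ_l^×` contains a torsion-free open
subgroup", [CombGC] proof of Prop. 2.4 (iv) p. 20.) [cite: MochizukiCombGC2007, Prop. 2.4 (iv) p.19] -/
theorem exists_pow_eq_pow_of_eqOn {χ χ' : G →* Kˣ} {m m' : ℕ} {U : Subgroup G} [U.FiniteIndex]
    (h : ∀ g ∈ U, χ g ^ m = χ' g ^ m') :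
    ∃ k : ℕ, 0 < k ∧ ∀ g : G, χ g ^ (k * m) = χ' g ^ (k * m') := by
  let N := U.normalCore
  haveI : N.FiniteIndex := Subgroup.finiteIndex_normalCore U
  refine ⟨N.index, Nat.pos_of_ne_zero Subgroup.FiniteIndex.index_ne_zero, fun g => ?_⟩
  have hg : g ^ N.index ∈ U := U.normalCore_le (Subgroup.pow_index_mem N g)
  have := h _ hg
  rwa [map_pow, map_pow, ← pow_mul, ← pow_mul] at this

omit [TopologicalSpace G] in
/-- Rescaling of weights along `χ^a = χ'^{a'}`: a character `ℚ`-cyclotomic of weight `w` relative to `χ` is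
`ℚ`-cyclotomic of weight `w · a'/a` relative to `χ'` (`θ^{ba} = χ^{ca} = χ'^{ca'}`).
[cite: MochizukiCombGC2007, Def. 2.3 (ii) p.18] -/
theorem isQCyclotomicOfWeightK_of_pow_eq {χ χ' : G →* Kˣ} {a a' : ℕ} (ha : 0 < a)
    (h : ∀ g : G, χ g ^ a = χ' g ^ a') {θ : G →* Kˣ} {w : ℚ} (hθ : IsQCyclotomicOfWeightK χ θ w) :
    IsQCyclotomicOfWeightK χ' θ (w * a' / a) := by
  obtain ⟨c, b, hb, e, hw⟩ := hθ
  refine ⟨c * a', b * a, by positivity, fun g => ?_, ?_⟩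
  · have h' : (χ g : Kˣ) ^ (a : ℤ) = χ' g ^ (a' : ℤ) := by rw [zpow_natCast, zpow_natCast, h g]
    calc θ g ^ (b * (a : ℤ)) = (θ g ^ b) ^ (a : ℤ) := zpow_mul _ _ _
      _ = (χ g ^ c) ^ (a : ℤ) := by rw [e g]
      _ = (χ g ^ (a : ℤ)) ^ c := by rw [← zpow_mul, ← zpow_mul, mul_comm]
      _ = (χ' g ^ (a' : ℤ)) ^ c := by rw [h']
      _ = χ' g ^ (c * (a' : ℤ)) := by rw [← zpow_mul, mul_comm]
  · rw [hw]
    have hb' : (b : ℚ) ≠ 0 := by exact_mod_cast hb.ne'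
    have ha' : (a : ℚ) ≠ 0 := by exact_mod_cast ha.ne'
    push_cast
    field_simp

/-! ### §2. Determinants agree along `e`: `χ^a = χ'^{a'}` -/

/-- **`χ^a = χ'^{a'}` for some `a, a' > 0`** when two Poincaré-extension modules (for reference characters
`χ`, `χ'`) are `G`-equivariantly isomorphic: `det V = det V'`, and `det² = χ^m`, `det'² = χ'^{m'}` on open
subgroups of finite index (A3). [cite: MochizukiCombGC2007, Prop. 2.4 (iii)(iv) p.19] -/
theorem pow_eq_pow_of_equivariant [FiniteDimensional K V] [FiniteDimensional K V'] {χ χ' : G →* Kˣ}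
    (ρ : G →* (V ≃ₗ[K] V)) (ρ' : G →* (V' ≃ₗ[K] V')) (e : V ≃ₗ[K] V')
    (he : ∀ (g : G) (v : V), e (ρ g v) = ρ' g (e v)) (hV : 0 < Module.finrank K V)
    {C : Submodule K V} (hC : IsStable ρ C)
    (hCt : ∃ U : Subgroup G, IsOpen (U : Set G) ∧ U.FiniteIndex ∧ ∀ g ∈ U, ∀ c ∈ C, ρ g c = (χ g : K) • c)
    (ρP : G →* ((V ⧸ C) ≃ₗ[K] (V ⧸ C))) (hρP : ∀ (g : G) (m : V), ρP g (C.mkQ m) = C.mkQ (ρ g m))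
    (B : (V ⧸ C) →ₗ[K] (V ⧸ C) →ₗ[K] K)
    (hB : ∀ (g : G) (p q : V ⧸ C), B (ρP g p) (ρP g q) = (χ g : K) * B p q)
    (hBl : ∀ p : V ⧸ C, (∀ q : V ⧸ C, B p q = 0) → p = 0)
    {C' : Submodule K V'} (hC' : IsStable ρ' C')
    (hCt' : ∃ U : Subgroup G, IsOpen (U : Set G) ∧ U.FiniteIndex ∧
      ∀ g ∈ U, ∀ c ∈ C', ρ' g c = (χ' g : K) • c)
    (ρP' : G →* ((V' ⧸ C') ≃ₗ[K] (V' ⧸ C'))) (hρP' : ∀ (g : G) (m : V'), ρP' g (C'.mkQ m) = C'.mkQ (ρ' g m))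
    (B' : (V' ⧸ C') →ₗ[K] (V' ⧸ C') →ₗ[K] K)
    (hB' : ∀ (g : G) (p q : V' ⧸ C'), B' (ρP' g p) (ρP' g q) = (χ' g : K) * B' p q)
    (hBl' : ∀ p : V' ⧸ C', (∀ q : V' ⧸ C', B' p q = 0) → p = 0) :
    ∃ a a' : ℕ, 0 < a ∧ 0 < a' ∧ ∀ g : G, χ g ^ a = χ' g ^ a' := by
  have hV' : 0 < Module.finrank K V' := e.finrank_eq ▸ hV
  obtain ⟨m, hm, -, U, -, hfi, hU⟩ := detSqQuasiCyclotomic_of_poincareExtension χ ρ hV hC hCt ρP hρP B hB hBl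
  obtain ⟨m', hm', -, U', -, hfi', hU'⟩ :=
    detSqQuasiCyclotomic_of_poincareExtension χ' ρ' hV' hC' hCt' ρP' hρP' B' hB' hBl'
  have hdet := detChar_eq_of_equivariant e he
  haveI := hfi
  haveI := hfi'
  haveI : (U ⊓ U').FiniteIndex := inferInstance
  have hUU : ∀ g ∈ U ⊓ U', χ g ^ m = χ' g ^ m' := fun g hg => by
    rw [← hU g hg.1, ← hU' g hg.2, hdet]
  obtain ⟨k, hk, hpow⟩ := exists_pow_eq_pow_of_eqOn hUU
  exact ⟨k * m, k * m', Nat.mul_pos hk hm, Nat.mul_pos hk hm', hpow⟩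

/-! ### §3. The power class of `χ^{cyclo}` is determined by the `G`-module -/

/-- Realised weights transfer along `e` with the rescaling `a'/a` (given `χ^a = χ'^{a'}`).
[cite: MochizukiAbsTopI2012, Lemma 4.5 (iii) p.54] -/
theorem realisedWeight_iff_of_pow_eq [FiniteDimensional K V] [FiniteDimensional K V'] {χ χ' : G →* Kˣ}
    {ρ : G →* (V ≃ₗ[K] V)} {ρ' : G →* (V' ≃ₗ[K] V')} (e : V ≃ₗ[K] V')
    (he : ∀ (g : G) (v : V), e (ρ g v) = ρ' g (e v)) {a a' : ℕ} (ha : 0 < a) (ha' : 0 < a')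
    (h : ∀ g : G, χ g ^ a = χ' g ^ a') (w : ℚ) :
    RealisedWeight χ ρ w ↔ RealisedWeight χ' ρ' (w * a' / a) := by
  constructor
  · rintro ⟨θ, hθ, hne⟩
    refine ⟨θ, isQCyclotomicOfWeightK_of_pow_eq ha h hθ, ?_⟩
    rwa [← quasiTrivialRank_twist_withTrivial_eq_of_equivariant e he]
  · rintro ⟨θ, hθ, hne⟩
    have hθ' := isQCyclotomicOfWeightK_of_pow_eq ha' (fun g => (h g).symm) hθ
    have hw : w * a' / a * a / a' = w := by
      have : (a : ℚ) ≠ 0 := by exact_mod_cast ha.ne'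
      have : (a' : ℚ) ≠ 0 := by exact_mod_cast ha'.ne'
      field_simp
    rw [hw] at hθ'
    refine ⟨θ, hθ', ?_⟩
    rwa [quasiTrivialRank_twist_withTrivial_eq_of_equivariant e he]

omit [TopologicalSpace G] in
/-- Two finite sets of rationals, each symmetric under `λ ↦ 2 − λ` and containing `0`, that differ by a
POSITIVE scaling `s` are equal scalings: `s = 1` (max + min = 2 on both sides).
[cite: MochizukiCombGC2007, Prop. 2.4 (vii) p.20] -/
theorem scale_eq_one_of_symmetric {S S' : Set ℚ} (hS : S.Finite) (h0 : (0 : ℚ) ∈ S)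
    (hsym : ∀ w, w ∈ S ↔ (2 - w) ∈ S) (hsym' : ∀ w, w ∈ S' ↔ (2 - w) ∈ S') {s : ℚ} (hs : 0 < s)
    (hscale : ∀ w, w ∈ S ↔ s * w ∈ S') : s = 1 := by
  obtain ⟨M, hM, hMmax⟩ := Set.exists_max_image S id hS ⟨0, h0⟩
  obtain ⟨μ, hμ, hμmin⟩ := Set.exists_min_image S id hS ⟨0, h0⟩
  have hsum : μ + M = 2 := by
    have h1 := hμmin _ ((hsym M).1 hM)
    have h2 := hMmax _ ((hsym μ).1 hμ)
    simp only [id] at h1 h2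
    linarith
  -- `s•M`, `s•μ` lie in `S'`; their mirror images come from elements of `S`
  have hback : ∀ w', w' ∈ S' → w' / s ∈ S := fun w' hw' => by
    rw [hscale, mul_div_cancel₀ _ hs.ne']
    exact hw'
  have h3 := hμmin _ (hback _ ((hsym' _).1 ((hscale M).1 hM)))
  have h4 := hMmax _ (hback _ ((hsym' _).1 ((hscale μ).1 hμ)))
  simp only [id] at h3 h4
  rw [le_div_iff₀ hs] at h3
  rw [div_le_iff₀ hs] at h4
  nlinarith

/-- **The power-equivalence class of `χ^{cyclo}` is DETERMINED by the abstract `G`-module** (anabelian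
content of [AbsTopI] Lemma 4.5 (iii), second sentence; [CombGC] Cor. 2.7 (i): "`ι` preserves the
`ℚ`-cyclotomic characters of weight `2`"): if the Poincaré-extension modules for reference characters
`χ`, `χ'` (non-degenerate, `C, C' ≠ 0`) are `G`-equivariantly isomorphic, then `χ^n = χ'^n` for some
`n > 0`. [cite: MochizukiAbsTopI2012, Lemma 4.5 (iii) p.54] [cite: MochizukiCombGC2007, Cor. 2.7 (i) proof p.23] -/
theorem powerEquivalent_of_equivariant [FiniteDimensional K V] [FiniteDimensional K V'] {χ χ' : G →* Kˣ}
    (hcyc : ∀ U : Subgroup G, IsOpen (U : Set G) → U.FiniteIndex → ∀ a : ℤ, a ≠ 0 → ∃ g ∈ U, χ g ^ a ≠ 1)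
    (hcyc' : ∀ U : Subgroup G, IsOpen (U : Set G) → U.FiniteIndex → ∀ a : ℤ, a ≠ 0 → ∃ g ∈ U, χ' g ^ a ≠ 1)
    (ρ : G →* (V ≃ₗ[K] V)) (ρ' : G →* (V' ≃ₗ[K] V')) (e : V ≃ₗ[K] V')
    (he : ∀ (g : G) (v : V), e (ρ g v) = ρ' g (e v)) (hV : 0 < Module.finrank K V)
    {C : Submodule K V} (hC : IsStable ρ C) (hC0 : C ≠ ⊥)
    (hCt : ∃ U : Subgroup G, IsOpen (U : Set G) ∧ U.FiniteIndex ∧ ∀ g ∈ U, ∀ c ∈ C, ρ g c = (χ g : K) • c)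
    (ρP : G →* ((V ⧸ C) ≃ₗ[K] (V ⧸ C))) (hρP : ∀ (g : G) (m : V), ρP g (C.mkQ m) = C.mkQ (ρ g m))
    (B : (V ⧸ C) →ₗ[K] (V ⧸ C) →ₗ[K] K)
    (hB : ∀ (g : G) (p q : V ⧸ C), B (ρP g p) (ρP g q) = (χ g : K) * B p q)
    (hBl : ∀ p : V ⧸ C, (∀ q : V ⧸ C, B p q = 0) → p = 0)
    {C' : Submodule K V'} (hC' : IsStable ρ' C') (hC0' : C' ≠ ⊥)
    (hCt' : ∃ U : Subgroup G, IsOpen (U : Set G) ∧ U.FiniteIndex ∧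
      ∀ g ∈ U, ∀ c ∈ C', ρ' g c = (χ' g : K) • c)
    (ρP' : G →* ((V' ⧸ C') ≃ₗ[K] (V' ⧸ C'))) (hρP' : ∀ (g : G) (m : V'), ρP' g (C'.mkQ m) = C'.mkQ (ρ' g m))
    (B' : (V' ⧸ C') →ₗ[K] (V' ⧸ C') →ₗ[K] K)
    (hB' : ∀ (g : G) (p q : V' ⧸ C'), B' (ρP' g p) (ρP' g q) = (χ' g : K) * B' p q)
    (hBl' : ∀ p : V' ⧸ C', (∀ q : V' ⧸ C', B' p q = 0) → p = 0) :
    ∃ n : ℕ, 0 < n ∧ ∀ g : G, χ g ^ n = χ' g ^ n := by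
  obtain ⟨a, a', ha, ha', hpow⟩ := pow_eq_pow_of_equivariant ρ ρ' e he hV hC hCt ρP hρP B hB hBl
    hC' hCt' ρP' hρP' B' hB' hBl'
  obtain ⟨hfin, hsym⟩ :=
    realisedWeightsSymmetric_of_poincareExtension χ hcyc ρ hC hC0 hCt ρP hρP B hB hBl
  obtain ⟨-, hsym'⟩ :=
    realisedWeightsSymmetric_of_poincareExtension χ' hcyc' ρ' hC' hC0' hCt' ρP' hρP' B' hB' hBl'
  have hs : (0 : ℚ) < (a' : ℚ) / a := by positivity
  have hscale : ∀ w, RealisedWeight χ ρ w ↔ RealisedWeight χ' ρ' ((a' : ℚ) / a * w) := fun w => by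
    rw [realisedWeight_iff_of_pow_eq e he ha ha' hpow w, div_mul_eq_mul_div, mul_comm]
  have h1 := scale_eq_one_of_symmetric (S := {w | RealisedWeight χ ρ w})
    (S' := {w | RealisedWeight χ' ρ' w}) hfin (zeroWeightRealised_holds χ ρ) hsym hsym' hs hscale
  have haa : a' = a := by
    have ha0 : (a : ℚ) ≠ 0 := by exact_mod_cast ha.ne'
    rw [div_eq_one_iff_eq ha0] at h1
    exact_mod_cast h1
  exact ⟨a, ha, fun g => by rw [hpow g, haa]⟩

/-! ### §4. The number of cusps is group-theoretic -/

/-- **The number of cusps is GROUP-THEORETIC** (anabelian content of [AbsTopI] Lemma 4.5 (iii) for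
Poincaré extensions; [CombGC] Cor. 2.7 (i) "this data allows one to compute `r(G′)`"): for CONTINUOUS
non-degenerate reference characters `χ, χ'` with values in a `T₁` topological field and `G`-equivariantly
isomorphic Poincaré-extension modules, the cuspidal parts have the same dimension, `dim C = dim C'`
(so `r = dim C + 1 = r'`).  Route: `χ`, `χ'` power-equivalent (§3) ⇒ `d_χ(V) = d_{χ'}(V)` (Lemma 4.5 (ii),
`dChi_eq_of_powerEquivalent`) `= d_{χ'}(V')` (`dChi_eq_of_equivariant`) and `d = dim C` on both sides
(`dChi_of_poincareExtension`). [cite: MochizukiAbsTopI2012, Lemma 4.5 (ii)(iii) p.54]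
[cite: MochizukiCombGC2007, Cor. 2.7 (i) proof p.23] -/
theorem finrank_cuspidal_eq_of_equivariant [FiniteDimensional K V] [FiniteDimensional K V']
    [IsTopologicalGroup G] [TopologicalSpace K] [T1Space K] [ContinuousMul K] {χ χ' : G →* Kˣ}
    (hχ : Continuous χ) (hχ' : Continuous χ')
    (hcyc : ∀ U : Subgroup G, IsOpen (U : Set G) → U.FiniteIndex → ∀ a : ℤ, a ≠ 0 → ∃ g ∈ U, χ g ^ a ≠ 1)
    (hcyc' : ∀ U : Subgroup G, IsOpen (U : Set G) → U.FiniteIndex → ∀ a : ℤ, a ≠ 0 → ∃ g ∈ U, χ' g ^ a ≠ 1)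
    (ρ : G →* (V ≃ₗ[K] V)) (ρ' : G →* (V' ≃ₗ[K] V')) (e : V ≃ₗ[K] V')
    (he : ∀ (g : G) (v : V), e (ρ g v) = ρ' g (e v)) (hV : 0 < Module.finrank K V)
    {C : Submodule K V} (hC : IsStable ρ C) (hC0 : C ≠ ⊥)
    (hCt : ∃ U : Subgroup G, IsOpen (U : Set G) ∧ U.FiniteIndex ∧ ∀ g ∈ U, ∀ c ∈ C, ρ g c = (χ g : K) • c)
    (ρP : G →* ((V ⧸ C) ≃ₗ[K] (V ⧸ C))) (hρP : ∀ (g : G) (m : V), ρP g (C.mkQ m) = C.mkQ (ρ g m))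
    (B : (V ⧸ C) →ₗ[K] (V ⧸ C) →ₗ[K] K)
    (hB : ∀ (g : G) (p q : V ⧸ C), B (ρP g p) (ρP g q) = (χ g : K) * B p q)
    (hBl : ∀ p : V ⧸ C, (∀ q : V ⧸ C, B p q = 0) → p = 0)
    {C' : Submodule K V'} (hC' : IsStable ρ' C') (hC0' : C' ≠ ⊥)
    (hCt' : ∃ U : Subgroup G, IsOpen (U : Set G) ∧ U.FiniteIndex ∧
      ∀ g ∈ U, ∀ c ∈ C', ρ' g c = (χ' g : K) • c)
    (ρP' : G →* ((V' ⧸ C') ≃ₗ[K] (V' ⧸ C'))) (hρP' : ∀ (g : G) (m : V'), ρP' g (C'.mkQ m) = C'.mkQ (ρ' g m))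
    (B' : (V' ⧸ C') →ₗ[K] (V' ⧸ C') →ₗ[K] K)
    (hB' : ∀ (g : G) (p q : V' ⧸ C'), B' (ρP' g p) (ρP' g q) = (χ' g : K) * B' p q)
    (hBl' : ∀ p : V' ⧸ C', (∀ q : V' ⧸ C', B' p q = 0) → p = 0) :
    Module.finrank K ↥C = Module.finrank K ↥C' := by
  have hpe := powerEquivalent_of_equivariant hcyc hcyc' ρ ρ' e he hV hC hC0 hCt ρP hρP B hB hBl
    hC' hC0' hCt' ρP' hρP' B' hB' hBl'
  have h1 := dChi_of_poincareExtension χ hcyc ρ hC hCt ρP hρP B hB hBl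
  have h2 := dChi_of_poincareExtension χ' hcyc' ρ' hC' hCt' ρP' hρP' B' hB' hBl'
  have h3 := dChi_eq_of_powerEquivalent ρ hχ hχ' hpe
  have h4 := dChi_eq_of_equivariant e he χ'
  have : (Module.finrank K ↥C : ℤ) = Module.finrank K ↥C' := by rw [← h1, h3, h4, h2]
  exact_mod_cast this

end Rigidity

end Literature.AnabelianGeometry.AbsoluteAnabelian.AbsTopI

end
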